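import Summits.AtomisticToContinuum.HydrodynamicLimit.Theorems.RelayRaceLocalityLightConeInLawSVCLine
import Mathlib.Analysis.Calculus.SmoothSeries
import Mathlib.Analysis.Calculus.Deriv.Inv
import Mathlib.Analysis.Calculus.Deriv.Pow

/-!
# Stub `stub_susceptibility` of the line `susceptibility-variance-continuity` for the crux `LightConeInLaw`
(stmt-AtomisticToContinuum-12500; route `RelayRaceLocality`, sub-problem `HydrodynamicLimit`)

The fluctuation–response (susceptibility) identity of an exponential family of weights on `ℕ`: for
`w ≥ 0` with `w 0 > 0` and `Σₙ wₙ rⁿ < ∞` for every `r > 0` (entire generating function) and a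
polynomially bounded `g`, the family mean `ν ↦ ⟨g⟩_ν = (Σₙ wₙ νⁿ g n) / (Σₙ wₙ νⁿ)` (`wMean w g`) has
`d/dν ⟨g⟩_ν = ν⁻¹ (⟨n g⟩_ν − ⟨n⟩_ν ⟨g⟩_ν) = ν⁻¹ Cov_ν(n, g)` at every `ν > 0`.

Proof: `wMean w g x = A x / Z x` for every `x`, with `A x = Σₙ (wₙ g n) xⁿ` and `Z x = wZ w x = Σₙ wₙ xⁿ`
(`tsum_div_const`). Both are real power series with infinite radius of convergence, hence differentiable
termwise on the open interval `(0, ν + 1)` (`hasDerivAt_tsum_of_isPreconnected` with the summable dominating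
sequence `|cₙ| (2(ν+1))ⁿ`, using `n ≤ 2ⁿ` and `(n+1)ᵏ ≤ (2ᵏ)ⁿ`); `Z ν ≥ w 0 > 0`; quotient rule
(`HasDerivAt.fun_div`); finally `ν A'(ν) = Σₙ (wₙ n g n) νⁿ` and `ν Z'(ν) = Σₙ (wₙ n) νⁿ` term by term.
Tree analogue: `hasDerivAt_integral_tilted_eq_covariance` (Literature, `QuantumLattice/WilsonFeynmanHellmann`).
-/

namespace Summit.AtomisticToContinuum.HydrodynamicLimit.Theorems.LightConeInLawSVC.Susceptibility

open scoped BigOperators Topology Classical ENNReal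
open Filter Set MeasureTheory
open Literature.MathematicalPhysics.KineticTheory Literature.Analysis.FluidPDE
open Summit.AtomisticToContinuum.HydrodynamicLimit.Theorems.LightConeInLawSketch
open Summit.AtomisticToContinuum.HydrodynamicLimit.Theorems.LightConeInLawSVC

noncomputable section

/-! ### Power series with infinite radius of convergence -/

/-- Termwise differentiation of a real power series `Σₙ cₙ xⁿ` with infinite radius of convergence
(`Σₙ |cₙ| rⁿ < ∞` for all `r > 0`) at a point `ν > 0`:
`d/dx Σₙ cₙ xⁿ |_{x=ν} = Σₙ cₙ n ν^{n-1}`. [folklore] -/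
theorem hasDerivAt_tsum_pow {c : ℕ → ℝ} (hc : ∀ r : ℝ, 0 < r → Summable fun n => |c n| * r ^ n)
    {ν : ℝ} (hν : 0 < ν) :
    HasDerivAt (fun x => ∑' n : ℕ, c n * x ^ n) (∑' n : ℕ, c n * ((n : ℝ) * ν ^ (n - 1))) ν := by
  set R : ℝ := ν + 1 with hR
  have hR1 : 1 ≤ R := by rw [hR]; linarith
  have hνR : ν ∈ Set.Ioo 0 R := ⟨hν, by rw [hR]; linarith⟩
  refine hasDerivAt_tsum_of_isPreconnected (u := fun n => |c n| * (2 * R) ^ n) (t := Set.Ioo 0 R)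
    (g := fun n x => c n * x ^ n) (g' := fun n x => c n * ((n : ℝ) * x ^ (n - 1))) (y₀ := ν)
    (hc (2 * R) (by positivity)) isOpen_Ioo isPreconnected_Ioo ?_ ?_ hνR ?_ hνR
  · intro n y _
    exact (hasDerivAt_pow n y).const_mul (c n)
  · intro n y hy
    rw [Real.norm_eq_abs, abs_mul, abs_mul, Nat.abs_cast, abs_of_nonneg (pow_nonneg hy.1.le _)]
    refine mul_le_mul_of_nonneg_left ?_ (abs_nonneg _)
    rw [mul_pow]
    have h2n : (n : ℝ) ≤ 2 ^ n := by exact_mod_cast (Nat.lt_two_pow_self).le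
    refine mul_le_mul h2n ?_ (pow_nonneg hy.1.le _) (pow_nonneg zero_le_two _)
    calc y ^ (n - 1) ≤ R ^ (n - 1) := pow_le_pow_left₀ hy.1.le hy.2.le _
      _ ≤ R ^ n := pow_le_pow_right₀ hR1 (Nat.sub_le n 1)
  · refine (hc ν hν).of_norm_bounded (fun n => ?_)
    rw [Real.norm_eq_abs, abs_mul, abs_of_nonneg (pow_nonneg hν.le _)]

/-! ### The exponential family `p_ν(n) ∝ wₙ νⁿ` -/

/-- The partition sum dominates its zeroth term: `0 < w 0 ≤ wZ w ν` for `w ≥ 0`, `ν > 0`. [folklore] -/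
theorem wZ_pos {w : ℕ → ℝ} (hw : ∀ n, 0 ≤ w n) (hw0 : 0 < w 0)
    (hsum : ∀ r : ℝ, 0 < r → Summable fun n => w n * r ^ n) {ν : ℝ} (hν : 0 < ν) : 0 < wZ w ν := by
  unfold wZ
  exact (hsum ν hν).tsum_pos (fun n => mul_nonneg (hw n) (pow_nonneg hν.le n)) 0 (by simpa using hw0)

/-- `wMean` is a quotient of two power series: `⟨g⟩_x = (Σₙ (wₙ g n) xⁿ) / Z_w(x)` for every `x` (no
summability needed: `tsum_div_const`). [folklore] -/
theorem wMean_eq_div (w g : ℕ → ℝ) (x : ℝ) :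
    wMean w g x = (∑' n : ℕ, w n * g n * x ^ n) / wZ w x := by
  unfold wMean wP
  rw [← tsum_div_const]
  exact tsum_congr fun n => by ring

/-- Polynomially bounded observables have entire weighted generating functions: if `w ≥ 0`,
`Σₙ wₙ rⁿ < ∞` for all `r > 0` and `|g n| ≤ B (n+1)ᵏ`, then `Σₙ |wₙ g n| rⁿ < ∞` for all `r > 0`
(compare with `B · wₙ (2ᵏ r)ⁿ`). [folklore] -/
theorem summable_abs_mul_pow {w g : ℕ → ℝ} (hw : ∀ n, 0 ≤ w n)
    (hsum : ∀ r : ℝ, 0 < r → Summable fun n => w n * r ^ n)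
    (hg : ∃ B : ℝ, ∃ k : ℕ, ∀ n, |g n| ≤ B * ((n : ℝ) + 1) ^ k) :
    ∀ r : ℝ, 0 < r → Summable fun n => |w n * g n| * r ^ n := by
  obtain ⟨B, k, hB⟩ := hg
  have hB0 : 0 ≤ B := by
    have h := hB 0
    simp only [Nat.cast_zero, zero_add, one_pow, mul_one] at h
    exact (abs_nonneg _).trans h
  intro r hr
  refine Summable.of_nonneg_of_le (fun n => by positivity) (fun n => ?_)
    ((hsum (2 ^ k * r) (by positivity)).mul_left B)
  have hwn := hw n
  -- `(n+1)ᵏ ≤ (2ⁿ)ᵏ = (2ᵏ)ⁿ`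
  have hnk : ((n : ℝ) + 1) ^ k ≤ ((2 : ℝ) ^ k) ^ n := by
    have h : (n : ℝ) + 1 ≤ 2 ^ n := by exact_mod_cast Nat.lt_two_pow_self
    calc ((n : ℝ) + 1) ^ k ≤ ((2 : ℝ) ^ n) ^ k := pow_le_pow_left₀ (by positivity) h k
      _ = ((2 : ℝ) ^ k) ^ n := by rw [← pow_mul, ← pow_mul, mul_comm]
  rw [abs_mul, abs_of_nonneg hwn]
  calc w n * |g n| * r ^ n ≤ w n * (B * ((n : ℝ) + 1) ^ k) * r ^ n := by gcongr; exact hB n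
    _ ≤ w n * (B * ((2 : ℝ) ^ k) ^ n) * r ^ n := by gcongr
    _ = B * (w n * (2 ^ k * r) ^ n) := by ring

/-- STUB `stub_susceptibility` of the line `susceptibility-variance-continuity` (registered signature verbatim).
**The susceptibility (fluctuation–response) identity for an exponential family of weights on `ℕ`:** for
`w ≥ 0` with `w 0 > 0` and entire generating function, and a polynomially bounded `g`, the family mean
`ν ↦ ⟨g⟩_ν = wMean w g ν` is differentiable at every `ν > 0` with
`d/dν ⟨g⟩_ν = ν⁻¹ (⟨n g⟩_ν − ⟨n⟩_ν ⟨g⟩_ν)`. [folklore] -/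
theorem stub_susceptibility :
    ∀ (w g : ℕ → ℝ), (∀ n, 0 ≤ w n) → 0 < w 0 →
      (∀ r : ℝ, 0 < r → Summable fun n => w n * r ^ n) →
      (∃ B : ℝ, ∃ k : ℕ, ∀ n, |g n| ≤ B * ((n : ℝ) + 1) ^ k) →
    ∀ ν : ℝ, 0 < ν →
      HasDerivAt (wMean w g)
        (ν⁻¹ * (wMean w (fun n => (n : ℝ) * g n) ν - wMean w (fun n => (n : ℝ)) ν * wMean w g ν)) ν := by
  intro w g hw hw0 hsum hg ν hν
  -- the numerator `A x = Σₙ (wₙ g n) xⁿ` and the partition sum `Z = wZ w`, differentiated termwise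
  have hA : HasDerivAt (fun x => ∑' n : ℕ, w n * g n * x ^ n)
      (∑' n : ℕ, w n * g n * ((n : ℝ) * ν ^ (n - 1))) ν :=
    hasDerivAt_tsum_pow (summable_abs_mul_pow hw hsum hg) hν
  have hZ : HasDerivAt (wZ w) (∑' n : ℕ, w n * ((n : ℝ) * ν ^ (n - 1))) ν := by
    have hc : ∀ r : ℝ, 0 < r → Summable fun n => |w n| * r ^ n := fun r hr =>
      (hsum r hr).congr fun n => by rw [abs_of_nonneg (hw n)]
    exact hasDerivAt_tsum_pow hc hν
  have hZpos : 0 < wZ w ν := wZ_pos hw hw0 hsum hν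
  have hZ0 : wZ w ν ≠ 0 := hZpos.ne'
  have hν0 : ν ≠ 0 := hν.ne'
  have hfun : wMean w g = fun x => (∑' n : ℕ, w n * g n * x ^ n) / wZ w x :=
    funext (wMean_eq_div w g)
  rw [hfun]
  refine (hA.fun_div hZ hZ0).congr_deriv ?_
  -- the value of the derivative: `ν A' = Σ (w n g) νⁿ`, `ν Z' = Σ (w n) νⁿ`
  have h1 : wMean w (fun n => (n : ℝ) * g n) ν =
      ν * (∑' n : ℕ, w n * g n * ((n : ℝ) * ν ^ (n - 1))) / wZ w ν := by
    rw [wMean_eq_div, ← tsum_mul_left]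
    congr 1
    refine tsum_congr fun n => ?_
    cases n with
    | zero => simp
    | succ m => simp only [Nat.add_one_sub_one, pow_succ]; ring
  have h2 : wMean w (fun n => (n : ℝ)) ν =
      ν * (∑' n : ℕ, w n * ((n : ℝ) * ν ^ (n - 1))) / wZ w ν := by
    rw [wMean_eq_div, ← tsum_mul_left]
    congr 1
    refine tsum_congr fun n => ?_
    cases n with
    | zero => simp
    | succ m => simp only [Nat.add_one_sub_one, pow_succ]; ring
  simp only [h1, h2]
  field_simp

end

end Summit.AtomisticToContinuum.HydrodynamicLimit.Theorems.LightConeInLawSVC.Susceptibility
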